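import Summits.ResolutionOfSingularities.ResolutionOfSingularities.Theorems.BoundaryLedgerModel
import Summits.ResolutionOfSingularities.ResolutionOfSingularities.Theorems.MaxContactCutItineraryCut
import HarnessLib

/-!
# NoJumpOrderQ — §1 of lens-5 g14 «NoJump» (decomp-res node N70, PROOF NODE, critic row 88 CLEARED)

Part 1 of 2 of `NoJump.lean` (sha256 05b2bacbf18a7deb), split only for the tree's 400-line file limit; the full module
docstring, the walk / jump sections and the by-name closing theorems are in `Theorems.NoJump`, which imports this file.
This part is §1 VERBATIM: the base range `ord F = q` — THE NEW LEMMA `not_isEquimultiplePoint_of_ordZero_eq` (every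
dimension, every `q ≥ 1`, every field): if `F` is cleaned of `q`-th powers, `ord F = q` exactly and `u_i ∣ F` for some
`i ≠ j`, then no point `b` of the `u_j`-chart with `b_j = 0`, `b_i ≠ 0` is equimultiple (proof in the docstring of
`Theorems.NoJump`, step (J3)).  Namespace `…Theorems.NoJump` (shared with part 2).  0 `sorry`.
[WRITER NOTE (decomp-res writer g5): verbatim split; imports as in the lens file.]
(Sources: Hauser2010 §§D,F; HauserPerlega2019 §3 Theorem (2),(7); Moh1987 §1.)
-/


noncomputable section

open MvPolynomial Finset
open scoped BigOperators
open Literature.AlgebraicGeometry.Resolution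
open Literature.AlgebraicGeometry.Resolution.Hauser2010
open Literature.AlgebraicGeometry.Resolution.PointBlowup
open Literature.AlgebraicGeometry.Resolution.WeightedBlowup
open Literature.Barriers.ResolutionOfSingularities
open Summit.ResolutionOfSingularities.ResolutionOfSingularities.Theses
open Summit.ResolutionOfSingularities.ResolutionOfSingularities.Theorems.TightDefectClasses
open Summit.ResolutionOfSingularities.ResolutionOfSingularities.Theorems.TightDefectStrongWalks
open Summit.ResolutionOfSingularities.ResolutionOfSingularities.Theorems.ItineraryCutClasses
open Summit.ResolutionOfSingularities.ResolutionOfSingularities.Theorems.BoundaryLedger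

namespace Summit.ResolutionOfSingularities.ResolutionOfSingularities.Theorems.NoJump


/-! ## §1 The base range `ord F = q`: no old component is lost at an equimultiple point (every dimension) -/

section OrderQ

variable {σ : Type*} {K : Type*} [Field K] [Fintype σ] [DecidableEq σ] [DecidableEq K]

/-- Degree of an erased exponent: `|E.erase i| + E i = |E|`. [folklore] -/
theorem degree_erase_add (E : σ →₀ ℕ) (i : σ) : (E.erase i).degree + E i = E.degree := by
  classical
  rw [Finsupp.degree_eq_sum, Finsupp.degree_eq_sum]
  · rw [← Finset.add_sum_erase Finset.univ (fun k => (E.erase i) k) (Finset.mem_univ i),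
      ← Finset.add_sum_erase Finset.univ (fun k => E k) (Finset.mem_univ i), Finsupp.erase_same, zero_add]
    have : ∑ k ∈ Finset.univ.erase i, (E.erase i) k = ∑ k ∈ Finset.univ.erase i, E k :=
      Finset.sum_congr rfl fun k hk => by rw [Finsupp.erase_ne (Finset.ne_of_mem_erase hk)]
    rw [this, add_comm]

omit [DecidableEq K] in
/-- The substitution `u_i := -b_i` (other variables unchanged) on a monomial. [folklore] -/
theorem aeval_subst_monomial (i : σ) (c : K) (D : σ →₀ ℕ) (a : K) :
    aeval (fun k => if k = i then C c else (X k : MvPolynomial σ K)) (monomial D a) =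
      monomial (D.erase i) (a * c ^ (D i)) := by
  classical
  rw [MvPolynomial.aeval_monomial, MvPolynomial.monomial_eq, Finsupp.prod_fintype _ _ (fun k => pow_zero _),
    Finsupp.prod_fintype _ _ (fun k => pow_zero _), ← Finset.mul_prod_erase Finset.univ _ (Finset.mem_univ i),
    ← Finset.mul_prod_erase Finset.univ (fun k => (X k : MvPolynomial σ K) ^ (D.erase i) k) (Finset.mem_univ i)]
  simp only [Finsupp.erase_same, pow_zero, one_mul, MvPolynomial.algebraMap_eq, C_mul, C_pow]
  have : ∏ k ∈ Finset.univ.erase i, (if k = i then C c else (X k : MvPolynomial σ K)) ^ D k =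
      ∏ k ∈ Finset.univ.erase i, (X k : MvPolynomial σ K) ^ (D.erase i) k :=
    Finset.prod_congr rfl fun k hk => by
      rw [if_neg (Finset.ne_of_mem_erase hk), Finsupp.erase_ne (Finset.ne_of_mem_erase hk)]
  rw [this, if_pos trivial]; ring

omit [DecidableEq K] in
/-- Coefficients after the substitution `u_i := -b_i`. [folklore] -/
theorem coeff_aeval_subst (i : σ) (c : K) (G : MvPolynomial σ K) (D' : σ →₀ ℕ) :
    coeff D' (aeval (fun k => if k = i then C c else (X k : MvPolynomial σ K)) G) =
      ∑ E ∈ G.support, if E.erase i = D' then coeff E G * c ^ (E i) else 0 := by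
  classical
  conv_lhs => rw [G.as_sum, map_sum, coeff_sum]
  refine Finset.sum_congr rfl fun E _ => ?_
  rw [aeval_subst_monomial, coeff_monomial]

/-- **THE NEW LEMMA (J3): no old exceptional component is lost at order exactly `q`.**  If `F` is cleaned of `q`-th
power monomials, `ord F = q` EXACTLY, and `u_i ∣ F` (`i ≠ j`), then no point `b` of the `u_j`-chart with
`b_j = 0` and `b_i ≠ 0` is equimultiple.  Every dimension, every field. [new]
(Sources: Hauser2010 §F; HauserPerlega2019 §3; Moh1987 §1 — none under this hypothesis/conclusion.) -/
theorem not_isEquimultiplePoint_of_ordZero_eq {q : ℕ} (j : σ) (b : σ → K) (hbj : b j = 0)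
    (s : State σ K) (hclean : deletePthPowers q s.F = s.F) (ho : ordZero s.F = (q : ℕ∞))
    {i : σ} (hij : i ≠ j) (hbi : b i ≠ 0) (hdiv : ∀ d ∈ s.F.support, 1 ≤ d i) :
    ¬ IsEquimultiplePoint q j b s := by
  classical
  intro heq
  set F := s.F with hF
  -- every monomial has degree ≥ q
  have hdeg : ∀ d ∈ F.support, q ≤ d.degree := by
    intro d hd
    have h1 := ordZero_le_of_coeff_ne_zero F d (MvPolynomial.mem_support_iff.mp hd)
    rw [ho] at h1
    exact_mod_cast h1
  -- the initial exponents and the `u_j`-free layer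
  set I : Finset (σ →₀ ℕ) := F.support.filter (fun d => d.degree = q) with hI
  set g : MvPolynomial σ K := ∑ d ∈ I, monomial (d.update j 0) (coeff d F) with hg
  set gt : MvPolynomial σ K := translate b g with hgt0
  have hgt : gt = ∑ d ∈ I, translate b (monomial (d.update j 0) (coeff d F)) := by
    rw [hgt0, hg]; unfold PointBlowup.translate; rw [map_sum]
  have hupd : ∀ (d : σ →₀ ℕ) (k : σ), (d.update j 0) k = if k = j then 0 else d k := by
    intro d k; rw [Finsupp.coe_update, Function.update_apply]
  -- (E1) the `u_j`-free coefficients of the point transform are those of `gt`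
  have hΦ : ∀ D : σ →₀ ℕ, D j = 0 → coeff D (pointTransform q j b s) = coeff D gt := by
    intro D hDj
    rw [pointTransform_eq_sum, hgt, coeff_sum, coeff_sum, ← hF,
      ← Finset.sum_filter_add_sum_filter_not F.support (fun d => d.degree = q)]
    have hrest : ∑ d ∈ F.support.filter (fun d => ¬ d.degree = q),
        coeff D (translate b (monomial (chartExponent q j d) (coeff d F))) = 0 := by
      refine Finset.sum_eq_zero fun d hd => ?_
      rw [Finset.mem_filter] at hd
      apply coeff_translate_monomial_eq_zero_of_apply_eq_zero b _ _ _ hbj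
      rw [hDj, chartExponent_apply, if_pos rfl]
      have := hdeg d hd.1
      omega
    rw [hrest, add_zero]
    refine Finset.sum_congr rfl fun d hd => ?_
    rw [Finset.mem_filter] at hd
    have hce : chartExponent q j d = d.update j 0 := by
      ext k
      rw [chartExponent_apply, hupd]
      split_ifs with hk
      · rw [hd.2, Nat.sub_self]
      · rfl
    rw [hce]
  -- (E2a) `gt` has no `u_j`
  have hgt_j : ∀ D : σ →₀ ℕ, D j ≠ 0 → coeff D gt = 0 := by
    intro D hDj
    rw [hgt, coeff_sum]
    refine Finset.sum_eq_zero fun d _ => ?_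
    apply coeff_translate_monomial_eq_zero_of_lt
    show (d.update j 0) j < D j
    rw [hupd, if_pos rfl]
    omega
  -- (E2b) `gt` has degree ≤ q
  have hgt_deg : ∀ D : σ →₀ ℕ, q < D.degree → coeff D gt = 0 := by
    intro D hD
    rw [hgt, coeff_sum]
    refine Finset.sum_eq_zero fun d hd => ?_
    rw [Finset.mem_filter] at hd
    by_contra hne
    have hle : D ≤ d.update j 0 := by
      rw [Finsupp.le_def]
      intro k
      by_contra hlt
      exact hne (coeff_translate_monomial_eq_zero_of_lt b _ _ _ (not_le.mp hlt))
    have hle2 : d.update j 0 ≤ d := by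
      rw [Finsupp.le_def]
      intro k
      rw [hupd]
      split_ifs <;> omega
    have h1 := degree_le_degree_of_le (hle.trans hle2)
    rw [hd.2] at h1
    omega
  -- (E2c) equimultiplicity: no monomials of degree `1 … q-1`
  have hstar : ∀ D : σ →₀ ℕ, D ≠ 0 → D.degree ≠ q → coeff D gt = 0 := by
    intro D hD0 hDq
    rcases lt_or_gt_of_ne hDq with h | h
    · by_cases hDj : D j = 0
      · rw [← hΦ D hDj]; exact heq D hD0 h
      · exact hgt_j D hDj
    · exact hgt_deg D h
  -- (E3) the coefficient of `u_i^q` in `gt` is the coefficient of the `q`-th power `u_i^q` in the cleaned `F`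
  have hqi : coeff (Finsupp.single i q) gt = 0 := by
    rw [hgt, coeff_sum]
    refine Finset.sum_eq_zero fun d hd => ?_
    rw [Finset.mem_filter] at hd
    by_contra hne
    have hle : ∀ k, (Finsupp.single i q) k ≤ (d.update j 0) k := fun k => by
      by_contra hlt
      exact hne (coeff_translate_monomial_eq_zero_of_lt b _ _ _ (not_le.mp hlt))
    have hdi : q ≤ d i := by
      have := hle i
      rw [Finsupp.single_eq_same, hupd, if_neg hij] at this
      exact this
    have hd_eq : d = Finsupp.single i q := by
      ext k
      by_cases hk : k = i
      · subst hk
        rw [Finsupp.single_eq_same]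
        have := Finsupp.le_degree k d
        omega
      · rw [Finsupp.single_eq_of_ne hk]
        have h1 := degree_erase_add d i
        have h2 := Finsupp.le_degree k (d.erase i)
        rw [Finsupp.erase_ne hk] at h2
        omega
    have hP : IsPthPowerExponent q d := by
      rw [isPthPowerExponent_iff]
      intro k
      rw [hd_eq, Finsupp.single_apply]
      split_ifs
      · exact dvd_rfl
      · exact dvd_zero q
    have hc : coeff d F = 0 := by
      have := coeff_deletePthPowers q F d
      rw [if_pos hP, hclean] at this
      exact this
    exact (MvPolynomial.mem_support_iff.mp hd.1) hc
  -- (E4) the substitution `u_i := -b_i` kills `gt` (because `u_i ∣ g`)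
  set ψ : MvPolynomial σ K →ₐ[K] MvPolynomial σ K :=
    aeval (fun k => if k = i then C (-b i) else (X k : MvPolynomial σ K)) with hψ
  have hψgt : ψ gt = 0 := by
    have hcomp : ψ (translate b g) =
        aeval (fun k => if k = i then (0 : MvPolynomial σ K) else X k + C (b k)) g := by
      unfold PointBlowup.translate
      rw [← AlgHom.comp_apply, MvPolynomial.comp_aeval]
      refine congrArg (fun f : σ → MvPolynomial σ K => aeval f g) (funext fun k => ?_)
      by_cases hk : k = i
      · rw [if_pos hk, hk]
        simp [hψ]
      · rw [if_neg hk]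
        simp [hψ, hk]
    rw [hgt0, hcomp, hg, map_sum]
    refine Finset.sum_eq_zero fun d hd => ?_
    rw [Finset.mem_filter] at hd
    rw [MvPolynomial.aeval_monomial, Finsupp.prod_fintype _ _ (fun k => pow_zero _),
      Finset.prod_eq_zero (Finset.mem_univ i)]
    · rw [mul_zero]
    · rw [if_pos rfl, hupd, if_neg hij]
      exact zero_pow (by have := hdiv d hd.1; omega)
  -- (E5) hence every degree-`q` coefficient of `gt` off `u_i^q` vanishes, and so does the constant one
  have hcoef : ∀ D' : σ →₀ ℕ, (∑ E ∈ gt.support, if E.erase i = D' then coeff E gt * (-b i) ^ (E i) else 0) = 0 := by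
    intro D'
    rw [← coeff_aeval_subst i (-b i) gt D', ← hψ, hψgt, coeff_zero]
  have hall : ∀ E : σ →₀ ℕ, coeff E gt = 0 := by
    intro E
    by_cases hEi : E = Finsupp.single i q
    · rw [hEi]; exact hqi
    by_cases hE0 : E = 0
    · -- the constant coefficient
      subst hE0
      have h := hcoef 0
      rw [Finset.sum_eq_single (0 : σ →₀ ℕ)] at h
      · simpa using h
      · intro E' hE' hE'0
        split_ifs with hE'e
        · -- `E'` is a pure power of `u_i` of degree `q`, i.e. `u_i^q`: coefficient zero
          have hq' : E'.degree = q := by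
            by_contra hne
            exact (MvPolynomial.mem_support_iff.mp hE') (hstar E' hE'0 hne)
          have : E' = Finsupp.single i q := by
            ext k
            by_cases hk : k = i
            · subst hk
              rw [Finsupp.single_eq_same]
              have h1 := degree_erase_add E' k
              rw [hE'e, map_zero] at h1
              omega
            · rw [Finsupp.single_eq_of_ne hk, ← Finsupp.erase_ne hk (f := E'), hE'e]
              rfl
          rw [this, hqi, zero_mul]
        · rfl
      · intro h0
        rw [if_pos (Finsupp.erase_zero i), MvPolynomial.notMem_support_iff.mp h0, zero_mul]
    -- a nonzero exponent: degree `q` or coefficient zero by `hstar`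
    by_cases hEq : E.degree = q
    swap
    · exact hstar E hE0 hEq
    have hD'0 : E.erase i ≠ 0 := by
      intro h0
      apply hEi
      ext k
      by_cases hk : k = i
      · subst hk
        rw [Finsupp.single_eq_same]
        have h1 := degree_erase_add E k
        rw [h0, map_zero] at h1
        omega
      · rw [Finsupp.single_eq_of_ne hk, ← Finsupp.erase_ne hk (f := E), h0]
        rfl
    have h := hcoef (E.erase i)
    rw [Finset.sum_eq_single E] at h
    · rw [if_pos rfl] at h
      rcases mul_eq_zero.mp h with h1 | h1
      · exact h1
      · exact absurd h1 (pow_ne_zero _ (neg_ne_zero.mpr hbi))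
    · intro E' hE' hne
      split_ifs with hE'e
      · exfalso
        apply hne
        have hE'0 : E' ≠ 0 := by
          intro h0; rw [h0, Finsupp.erase_zero] at hE'e; exact hD'0 hE'e.symm
        have hq' : E'.degree = q := by
          by_contra hne'
          exact (MvPolynomial.mem_support_iff.mp hE') (hstar E' hE'0 hne')
        ext k
        by_cases hk : k = i
        · subst hk
          have h1 := degree_erase_add E' k
          have h2 := degree_erase_add E k
          rw [hE'e] at h1
          omega
        · have := congrArg (fun f : σ →₀ ℕ => f k) hE'e
          simp only [Finsupp.erase_ne hk] at this
          exact this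
      · rfl
    · intro h0
      rw [if_pos rfl, MvPolynomial.notMem_support_iff.mp h0, zero_mul]
  -- (E6) so `gt = 0`, `g = 0`, and an initial coefficient of `F` vanishes
  have hgt_zero : gt = 0 := by ext E; rw [hall E, coeff_zero]
  have hg_zero : g = 0 := by
    have := translate_neg_translate b g
    rw [← hgt0, hgt_zero] at this
    rw [← this]; unfold PointBlowup.translate; rw [map_zero]
  obtain ⟨⟨d₀, hd₀, hd₀deg⟩, -⟩ := (ordZero_eq_nat_iff F q).mp ho
  have hd₀I : d₀ ∈ I := Finset.mem_filter.mpr ⟨MvPolynomial.mem_support_iff.mpr hd₀, hd₀deg⟩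
  have hcoeff : coeff (d₀.update j 0) g = coeff d₀ F := by
    rw [hg, coeff_sum, Finset.sum_eq_single d₀]
    · rw [coeff_monomial, if_pos rfl]
    · intro d hd hne
      rw [coeff_monomial, if_neg]
      intro hupdeq
      apply hne
      rw [Finset.mem_filter] at hd
      ext k
      by_cases hk : k = j
      · subst hk
        have h1 := degree_erase_add d k
        have h2 := degree_erase_add d₀ k
        have h3 : d.erase k = d₀.erase k := by
          ext l
          by_cases hl : l = k
          · subst hl; rw [Finsupp.erase_same, Finsupp.erase_same]
          · rw [Finsupp.erase_ne hl, Finsupp.erase_ne hl]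
            have := congrArg (fun f : σ →₀ ℕ => f l) hupdeq
            simp only [hupd, if_neg hl] at this
            exact this
        rw [h3, hd.2] at h1
        rw [hd₀deg] at h2
        omega
      · have := congrArg (fun f : σ →₀ ℕ => f k) hupdeq
        simp only [hupd, if_neg hk] at this
        exact this
    · intro h; exact absurd hd₀I h
  rw [hg_zero, coeff_zero] at hcoeff
  exact hd₀ hcoeff.symm

end OrderQ

end Summit.ResolutionOfSingularities.ResolutionOfSingularities.Theorems.NoJump
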